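import Summits.QuantumFields.YangMills.Theorems.BalabanUVNodesK0Stub1Eq157FlatScaledS1
import Summits.QuantumFields.YangMills.Theorems.BalabanUVNodesK0Stub1FlatChartLineStationarity
import Summits.QuantumFields.YangMills.Theorems.UnitScaleTiltProp8Chart47Analytic
import HarnessLib

/-!
# K0⁷ STUB 1 (`stub_prop8StepCoP13` ∕ V20-G `stub_prop8StepCoPG13`), sub-target S4b — **THE ♭ (127) SOCKET AT THE RECORD: `⟪δX, Δ_1X₁⟫ + Re BE(W A′₁)(δ) = 0` FOR EVERY
# KERNEL DIRECTION `δ` AT EVERY SMALL HERMITIAN-TRACELESS `A′₁` WHOSE ♭-CHARTED CONFIGURATION `e^{iη(A′₁ − H♭Dsel♭A′₁)}` IS CRITICAL ON THE RECORD's FIBRE** — the A6 junction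
# D‴ (`…SectFWSlotAtRecordFlatScaledExistsHerm0`) ∘ this seat's `…K0Stub1Eq157FlatScaledS1` §3 ∘ dag-k0-s1-w1's `…K0Stub1FlatChartCriticalityTransfer` §3 (stationarity along the
# charted curve, through their `…K0Stub1FlatChartLineStationarity` §4 `exists_suReading_hasDerivAt_wilsonAction4_zero_of_letters`, p640294)

Cell `pub-ymgap`, width seat `pub-ymgap-k0-s1-w2` g6 (CLAIM-3; dag-k0-s1-w1 g7 I.37608 «THE JUNCTION YOU CAN WRITE AGAINST IT … the chain rule gives `0 = d∕dt 𝔄(e^{iη chart♭(A′₁+tδ)})|₀ =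
⟨δ, Δ₁A′₁⟩ + B(W, δ)` = the S4a `h127rec` with `T = 0`»).  `--kind proof --supports stmt-QuantumFields-20541 --as helper`; count-neutral; def-free.
[15] = [Balaban1985Variational]; [B7] = [Balaban1985Averaging]; [B6] = [Balaban1984PropagatorsII]; [III] = [Balaban1988Convergent].

WHY.  The three inputs of the ♭ (127) are in the tree: (a) STATIONARITY of the Wilson action along the charted line `t ↦ e^{iη((A′₁ + tδ) − H♭Dsel♭(A′₁ + tδ))}` through a
fibre-critical charted point, with the line's `hball` ((55)♭ + the row of `H♭`), `hidx` ((48)♭ + `Qlin♭δ = 0`) and `SU(N)` readings (reality of `Dsel♭`) ALL DISCHARGED from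
letters (dag-k0-s1-w1 g8 `exists_suReading_hasDerivAt_wilsonAction4_zero_of_letters`, p640294, over their FILE 5 p638041); (b) the (157) split of the action along the ♭
chart and the line derivative of `V_S` (this seat's `inner_hessOpAt_add_re_eq_zero_of_stationary`, p639677); (c) Sect. F's current `W` at instance (S) with the (157)
certificate AND the reality of the implicit ♭ chart (D‴ p641192, over dag-k0-s1-w4's p639186).  THIS FILE plugs (a) into (b): the herm0-guarded tangent curve `Xc t` reads, in
S1's exponential chart at `1`, the SAME `SU(N)` configuration as dag-k0-s1-w1's `U t` (p639677 §1 `coe_expChart_one_eq_coe_expCfg`), so their stationarity transports to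
`HasDerivAt (t ↦ 𝔄(expChart 1 (Xc t))) 0 0` by `congr_of_eventuallyEq`, and (b) returns `⟪δX, Δ_1X₁⟫ + Re φ(δ) = 0`; the companion `…SocketFlatAtRecordExists` feeds (c)'s
objects and discharges the row and the radius.

WHAT IS PROVED (sorry-free; no definition; axioms standard; `F : T4Family`, `P = F.P K`, `N ≥ 1`).
* §1 ★★★ `socket127_flat_of_letters` — at ONE family: nested `D` (`D.k = k`, collar), the (152) weights, the letters of D‴ BY SHAPE (`τ = ntr`, `B = Σ_t τ`, `M♭`, `H♭` kernel
  formulas, `Dsel` with (55)♭ ∕ `ContDiffOn ℂ ω` ∕ (48)♭ ∕ reality on the `ε`-ball), the sup row `B♭` of `H♭`, a radius `R` with `60800ℓ²LR ≤ 1`, `60ℓ²LR < δ_N`,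
  `ε + B♭C_Dε² ≤ R`; a Hermitian-traceless `A′₁` in the `ε`-ball with the (157) certificate `HasFDerivAt V_S φ A′₁`, a Hermitian-traceless `δ` with `Qlin♭δ = 0`, an `SU(N)` reading
  `U₁` of `e^{iη(A′₁ − H♭Dsel A′₁)}` critical on the record's fibre (`Node00.IsCritOnFibre F N K 𝔹 (avgFamily (avOfRecord F N K) U₁) U₁`, `𝔹` on (2.3) index bonds of levels `≤ k`)
  and tangent letters `⇑X₁ = iη•A′₁`, `⇑δX = iη•δ` ⟹ **`⟪δX, Δ_1X₁⟫ + Re φ(δ) = 0`**.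
HONEST SCOPE.  A junction: first-order calculus and bookkeeping over files cited BY NAME; NO estimate of [15]; the CRITICALITY of the charted configuration on the record's fibre is
the displayed in-edge (the K0 road's minimiser-to-criticality step: modules 35∕37, the Landau∕axial copy, dag-k0-s1-w1 `isCritOnFibre_gaugeAct_avgFamily_iff`); the kernel is
PRINT's straight multi-level kernel `Qlin♭δ = 0` (the dictionary to the record's `dIterL` kernel modulo pure gauges is dag-k0-s1-w1's `…FlatAveragingDictionary(Levels)`); the
conversion to the `K_V`-currency of `h128` is p624107 `socket_curlCurlExt_iff_socket_hessOpAt_inner` (not restated); `stub_prop8StepCoP13` ∕ `stub_prop8StepCoPG13` ∕ K0⁷ NOT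
closed; N07 NOT discharged; no summit statement is proved by this seat; counts unmoved (28∕28 · 5∕27); one finite 𝕋⁴ programme at fixed ε — R4 closes the conditional finite-𝕋⁴
rung `BalabanLadder.UV` only, never the summit; the YM mass gap (Clay) is NOT proved by any of this; nothing continuum ∕ ℝ⁴ ∕ OS.  No `sorry`, no `def`, no `instance`, no `notation`.

References: [15] (20) p.281, (22) p.281, (27) p.282, (44)–(50) p.285, (55) p.286, (80) p.290, (127)–(128) p.297, (152) p.301, (156)–(158) p.302; [B7] (17) p.21, (92) p.31,
Prop. 4 (134)–(135) p.38; [B6] (2.3) p.224, (2.35) p.228; [III] (2.10)–(2.12) p.256; [Balaban1987RG1] (0.1) p.251, (0.4) p.253.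
-/

set_option autoImplicit false

noncomputable section

open scoped BigOperators Matrix InnerProductSpace RealInnerProductSpace Matrix.Norms.L2Operator Topology ContDiff
open Filter

namespace Summit.QuantumFields.YangMills.Theorems.K0Stub1SocketFlatAtRecord

open Literature.MathematicalPhysics.QuantumFieldTheory.Balaban1983to89
open Literature.MathematicalPhysics.QuantumFieldTheory.Balaban1983to89.Node00
open T4Continuum (T4Family)
open ExpMeanLog (deltaSU deltaSU_pos)
open T4AdjointCovarianceUnitary (lieSU)
open B9AdOrthogonal (herm0)
open B15DeterminingSets (bondsOf DetSet avgFamily)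
open B6SectADomainsV1 (Domains)
open B6SectAOperatorsV1 (BondIdx aE)
open B6SectAVectorModelV1 (EE)
open B11Eq26ActionExpansion (V0)
open MatrixNorms (ntr)
open Summit.QuantumFields.YangMills.Theorems.K0FlatCubeOpsTextP (IsLevWeight flatH)
open Summit.QuantumFields.YangMills.Theorems.Prop8Chart (expCfg)
open Summit.QuantumFields.YangMills.Theorems.Prop8ChartDoubleBar (chartLogFlat)
open Summit.QuantumFields.YangMills.Theorems.Chart47Analytic (isOpen_wBall)
open Summit.QuantumFields.YangMills.Theorems.K0Stub1Eq157FlatScaledS1 (inner_hessOpAt_add_re_eq_zero_of_stationary coe_expChart_one_eq_coe_expCfg)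
open Summit.QuantumFields.YangMills.Theorems.K0Stub1FlatChartCriticalityTransfer (eventually_ofReal)
open Summit.QuantumFields.YangMills.Theorems.K0Stub1FlatChartLineStationarity (exists_suReading_hasDerivAt_wilsonAction4_zero_of_letters)
open Summit.QuantumFields.YangMills.BalabanUVNodes.N07ChartLogReality (I_eta_smul_mem_lieSU)

/-! ## §1  The ♭ (127) socket at one family, letters displayed -/

section Letters

variable (F : T4Family) (N : ℕ) [NeZero N] (K k : ℕ) (D : Domains (F.P K)) (hDk : D.k = k)
  (hcollar : ∀ (i : ℕ) (e : PBond (F.P K) (i + 1)), D.LamBond (i + 1) e → ∀ z : Site (F.P K) i, (blockOf z = e.src ∨ blockOf z = e.tgt) → z ∈ D.Om i)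

include hDk hcollar in
/-- ★★★ **THE ♭ (127) SOCKET, LETTERS DISPLAYED** (see the module docstring, §1). [cite: Balaban1985Variational, (127)-(128) p.297, (157) p.302, (44)-(50) p.285, (55) p.286, (80) p.290; Balaban1985Averaging, (92) p.31, Prop. 4 (134)-(135) p.38; Balaban1988Convergent, (2.10)-(2.12) p.256] -/
theorem socket127_flat_of_letters {w : ℕ → PBond (F.P K) 0 → ℝ} (hw : IsLevWeight (F.P K) k D w)
    (hc : ((F.P K).L : ℝ) ^ k ≠ 0) (hwa : ∀ _i : BondIdx D, (0 : ℝ) < 1)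
    (τ : Matrix (Fin N) (Fin N) ℂ →L[ℂ] ℂ) (hntr : ∀ X, τ X = ntr X)
    (B : (BondIdx D → Matrix (Fin N) (Fin N) ℂ) →L[ℂ] (BondIdx D → Matrix (Fin N) (Fin N) ℂ) →L[ℂ] ℂ)
    (hB : ∀ X X' : BondIdx D → Matrix (Fin N) (Fin N) ℂ, B X X' = ∑ t, τ (X t * X' t))
    (MV : (BondIdx D → Matrix (Fin N) (Fin N) ℂ) →L[ℂ] (BondIdx D → Matrix (Fin N) (Fin N) ℂ))
    (hMV : ∀ (X : BondIdx D → Matrix (Fin N) (Fin N) ℂ) (t : BondIdx D),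
      MV X t = ∑ s, (((((F.P K).L : ℝ) ^ (t.1.1 : ℕ) * ((((F.P K).L : ℝ))⁻¹) ^ k)⁻¹ *
        WithLp.ofLp ((EE D hc hwa - aE D (fun _ => (1 : ℝ))) (WithLp.toLp 2 (Pi.single s 1))) t *
        (((F.P K).L : ℝ) ^ (s.1.1 : ℕ) * ((((F.P K).L : ℝ))⁻¹) ^ k)⁻¹ : ℝ) : ℂ) • X s)
    (H : (BondIdx D → Matrix (Fin N) (Fin N) ℂ) →ₗ[ℂ] (PBond (F.P K) 0 → Matrix (Fin N) (Fin N) ℂ))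
    (hH : ∀ (X : BondIdx D → Matrix (Fin N) (Fin N) ℂ) (b : PBond (F.P K) 0), H X b =
      ∑ t, (((((F.P K).L : ℝ) ^ (t.1.1 : ℕ) * ((((F.P K).L : ℝ))⁻¹) ^ k)⁻¹ * flatH (F.P K) k D (Pi.single t 1) b : ℝ) : ℂ) • X t)
    {Bf : ℝ} (hBf : 0 ≤ Bf)
    (hHB : ∀ (X : BondIdx D → Matrix (Fin N) (Fin N) ℂ) (t : ℝ), 0 ≤ t → (∀ i, ‖X i‖ ≤ t) → ∀ b, w 1 b * ‖H X b‖ ≤ Bf * t)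
    (Dsel : (PBond (F.P K) 0 → Matrix (Fin N) (Fin N) ℂ) → (BondIdx D → Matrix (Fin N) (Fin N) ℂ)) {ε CD : ℝ} (hε : 0 < ε) (hCD : 0 ≤ CD)
    (h55 : ∀ A' : PBond (F.P K) 0 → Matrix (Fin N) (Fin N) ℂ, (∀ b, w 1 b * ‖A' b‖ < ε) →
      ∀ ρ' : ℝ, 0 ≤ ρ' → (∀ b, w 1 b * ‖A' b‖ ≤ ρ') → ∀ i : BondIdx D, ‖Dsel A' i‖ ≤ CD * ρ' ^ 2)
    (hcd : ContDiffOn ℂ ω Dsel {Y : PBond (F.P K) 0 → Matrix (Fin N) (Fin N) ℂ | ∀ b, w 1 b * ‖Y b‖ < ε})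
    (h48 : ∀ A' : PBond (F.P K) 0 → Matrix (Fin N) (Fin N) ℂ, (∀ b, w 1 b * ‖A' b‖ < ε) →
      chartLogFlat ((((F.P K).L : ℝ)⁻¹) ^ k) D (A' - H (Dsel A')) = (fderiv ℂ (chartLogFlat ((((F.P K).L : ℝ)⁻¹) ^ k) D :
        (PBond (F.P K) 0 → Matrix (Fin N) (Fin N) ℂ) → BondIdx D → Matrix (Fin N) (Fin N) ℂ) 0) A')
    (hherm : ∀ A' : PBond (F.P K) 0 → Matrix (Fin N) (Fin N) ℂ, (∀ b, w 1 b * ‖A' b‖ < ε) → (∀ b, A' b ∈ herm0 (Fin N)) →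
      (∀ i, Dsel A' i ∈ herm0 (Fin N)) ∧ ∀ b, (A' - H (Dsel A')) b ∈ herm0 (Fin N))
    -- the radius of dag-k0-s1-w1's transfer and the smallness of `ε` against it
    {R : ℝ} (hRL : 60800 * ((((F.P K).d + 2) * (F.P K).L : ℕ) : ℝ) ^ 2 * ((F.P K).L : ℝ) * R ≤ 1)
    (hguard : 60 * ((((F.P K).d + 2) * (F.P K).L : ℕ) : ℝ) ^ 2 * ((F.P K).L : ℝ) * R < deltaSU (Fin N)) (hεR : ε + Bf * CD * ε ^ 2 ≤ R)
    -- the base point, the (157) certificate there, the kernel direction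
    (A₁ δ : PBond (F.P K) 0 → Matrix (Fin N) (Fin N) ℂ) (hA₁ : ∀ b, w 1 b * ‖A₁ b‖ < ε) (hA₁h : ∀ b, A₁ b ∈ herm0 (Fin N)) (hδh : ∀ b, δ b ∈ herm0 (Fin N))
    (hδQ : (fderiv ℂ (chartLogFlat ((((F.P K).L : ℝ)⁻¹) ^ k) D :
      (PBond (F.P K) 0 → Matrix (Fin N) (Fin N) ℂ) → BondIdx D → Matrix (Fin N) (Fin N) ℂ) 0) δ = 0)
    {φ : (PBond (F.P K) 0 → Matrix (Fin N) (Fin N) ℂ) →L[ℂ] ℂ}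
    (h157 : HasFDerivAt (fun A : PBond (F.P K) 0 → Matrix (Fin N) (Fin N) ℂ =>
        2⁻¹ * B (Dsel A) (((((((((F.P K).L : ℝ))⁻¹) ^ k : ℝ) : ℂ) ^ (F.P K).d) • MV) (Dsel A))
          - B ((fderiv ℂ (chartLogFlat (((((F.P K).L : ℝ))⁻¹) ^ k) D :
              (PBond (F.P K) 0 → Matrix (Fin N) (Fin N) ℂ) → BondIdx D → Matrix (Fin N) (Fin N) ℂ) 0) A)
              (((((((((F.P K).L : ℝ))⁻¹) ^ k : ℝ) : ℂ) ^ (F.P K).d) • MV) (Dsel A))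
          + V0 (LatticeFieldCalculus.shiftEquiv (P := F.P K) (j := 0)) (fun _ _ => (1 : (Matrix (Fin N) (Fin N) ℂ)ˣ)) ((((F.P K).L : ℝ)⁻¹) ^ k) (F.P K).d
              (τ : Matrix (Fin N) (Fin N) ℂ →ₗ[ℂ] ℂ) (fun μ x => (A - H (Dsel A)) ⟨x, μ⟩)) φ A₁)
    -- the criticality of the charted configuration on the record's fibre
    (𝔹 : DetSet (F.P K)) (h𝔹 : ∀ (j : ℕ) (b : PBond (F.P K) j), b ∈ bondsOf (𝔹 j) → j ≤ k ∧ D.LamBond j b)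
    (U₁ : GaugeField (F.P K) 0 (SU N))
    (hU₁ : ∀ b, ((U₁ b : SU N) : Matrix (Fin N) (Fin N) ℂ) = ((expCfg ((((F.P K).L : ℝ)⁻¹) ^ k) (A₁ - H (Dsel A₁)) b : (Matrix (Fin N) (Fin N) ℂ)ˣ) : _))
    (hcrit : IsCritOnFibre F N K 𝔹 (avgFamily (avOfRecord F N K) U₁) U₁)
    -- the tangent letters
    (X₁ δX : TangentBondSU (F.P K) 0 N)
    (hX₁ : ∀ b, ((X₁ b : lieSU (Fin N)) : Matrix (Fin N) (Fin N) ℂ) = (Complex.I * (((((F.P K).L : ℝ)⁻¹) ^ k : ℝ) : ℂ)) • A₁ b)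
    (hδX : ∀ b, ((δX b : lieSU (Fin N)) : Matrix (Fin N) (Fin N) ℂ) = (Complex.I * (((((F.P K).L : ℝ)⁻¹) ^ k : ℝ) : ℂ)) • δ b) :
    ⟪δX, hessOpAt ((((F.P K).L : ℝ)⁻¹) ^ k) (1 : GaugeField (F.P K) 0 (SU N)) X₁⟫_ℝ + (φ δ).re = 0 := by
  classical
  set η : ℝ := (((F.P K).L : ℝ)⁻¹) ^ k with hηdef
  have hd : (F.P K).d = 4 := T4Family.P_d F K
  have hR0 : 0 ≤ R := le_trans (by positivity) hεR
  -- (a) dag-k0-s1-w1's stationarity along the charted line (p640294 §4: the complex charted family `(A′₁ + zδ) − H♭Dsel♭(A′₁ + zδ)`, `hball` by (55)♭ + the row,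
  -- `hidx` by (48)♭ + the kernel, `SU(N)` readings by the reality of the chart, dag-k0-s1-w1 FILE 5's transfer)
  obtain ⟨U, -, hUread, hstatU⟩ := exists_suReading_hasDerivAt_wilsonAction4_zero_of_letters F N K k D hDk hcollar hw hR0 hRL hguard H Dsel hε.le le_rfl hCD hεR
    hHB h55 hcd h48 hherm A₁ δ hA₁ hA₁h hδQ hδh U₁ hU₁ 𝔹 h𝔹 hcrit
  -- the line stays in the `ε`-ball near `0`
  have hlin : Continuous fun z : ℂ => A₁ + z • δ := continuous_const.add (continuous_id.smul continuous_const)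
  have hball₁ : ∀ᶠ z in 𝓝 (0 : ℂ), ∀ b, w 1 b * ‖(A₁ + z • δ) b‖ < ε := by
    have h0 : (fun z : ℂ => A₁ + z • δ) 0 ∈ {Y : PBond (F.P K) 0 → Matrix (Fin N) (Fin N) ℂ | ∀ b, w 1 b * ‖Y b‖ < ε} := by
      simpa only [Set.mem_setOf_eq, zero_smul, add_zero] using hA₁
    exact hlin.continuousAt.eventually_mem ((isOpen_wBall (w 1) ε).mem_nhds h0)
  -- reality along the real line: the tangent curve and the `SU(N)` readings
  have hreal : ∀ᶠ t : ℝ in 𝓝 0, (∀ b, w 1 b * ‖(A₁ + (t : ℂ) • δ) b‖ < ε) ∧ ∀ b, (A₁ + (t : ℂ) • δ) b ∈ herm0 (Fin N) := by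
    filter_upwards [eventually_ofReal hball₁] with t ht
    refine ⟨ht, fun b => ?_⟩
    rw [Pi.add_apply, Pi.smul_apply, Complex.coe_smul]
    exact Submodule.add_mem _ (hA₁h b) (Submodule.smul_mem _ t (hδh b))
  have hDh : ∀ᶠ t : ℝ in 𝓝 0, ∀ i, Dsel (A₁ + (t : ℂ) • δ) i ∈ herm0 (Fin N) := hreal.mono fun t ht => (hherm _ ht.1 ht.2).1
  set A : ℂ → PBond (F.P K) 0 → Matrix (Fin N) (Fin N) ℂ := fun z => (A₁ + z • δ) - H (Dsel (A₁ + z • δ)) with hA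
  let Xc : ℝ → TangentBondSU (F.P K) 0 N := fun t => WithLp.toLp 2 fun b =>
    if h : A (t : ℂ) b ∈ herm0 (Fin N) then ⟨(Complex.I * (η : ℂ)) • A (t : ℂ) b, I_eta_smul_mem_lieSU η h⟩ else 0
  have hXc : ∀ᶠ t : ℝ in 𝓝 0, ∀ b, ((Xc t b : lieSU (Fin N)) : Matrix (Fin N) (Fin N) ℂ) =
      (Complex.I * (η : ℂ)) • ((A₁ + (t : ℂ) • δ) b - H (Dsel (A₁ + (t : ℂ) • δ)) b) := by
    filter_upwards [hreal] with t ht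
    intro b
    have hmem : A (t : ℂ) b ∈ herm0 (Fin N) := (hherm _ ht.1 ht.2).2 b
    have hval : (Xc t b : lieSU (Fin N)) = ⟨(Complex.I * (η : ℂ)) • A (t : ℂ) b, I_eta_smul_mem_lieSU η hmem⟩ := by
      show (if h : A (t : ℂ) b ∈ herm0 (Fin N) then (⟨(Complex.I * (η : ℂ)) • A (t : ℂ) b, I_eta_smul_mem_lieSU η h⟩ : lieSU (Fin N)) else 0) = _
      rw [dif_pos hmem]
    rw [hval]
    simp only [hA, Pi.sub_apply]
  -- the tangent curve reads the same `SU(N)` configuration as dag-k0-s1-w1's `U`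
  have hstat : HasDerivAt (fun t : ℝ => wilsonAction4 (expChart (1 : GaugeField (F.P K) 0 (SU N)) (WithLp.ofLp (Xc t)))) 0 0 := by
    refine hstatU.congr_of_eventuallyEq ?_
    filter_upwards [hUread, hXc] with t hUt hXt
    show wilsonAction4 (expChart (1 : GaugeField (F.P K) 0 (SU N)) (WithLp.ofLp (Xc t))) = wilsonAction4 (U t)
    congr 1
    funext b
    exact Subtype.ext ((coe_expChart_one_eq_coe_expCfg η (WithLp.ofLp (Xc t)) ((A₁ + (t : ℂ) • δ) - H (Dsel (A₁ + (t : ℂ) • δ))) hXt b).trans (hUt b).symm)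
  -- (b) the (157) split turns it into the socket equation
  exact inner_hessOpAt_add_re_eq_zero_of_stationary D k hd hc hwa τ hntr B hB MV hMV H hH Dsel A₁ δ hA₁h hδh hDh X₁ δX hX₁ hδX Xc hXc h157 hstat

end Letters

end Summit.QuantumFields.YangMills.Theorems.K0Stub1SocketFlatAtRecord

end
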